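/-
Copyright (c) 2026 the pub-hodgecm-mathlib formalisation cell (harness21).  Prover seat hodgecm-mathlib-LH7-p08 (g2) (Track A hand on the K2-lead VALVE),
#184♮ = hLiu418 = `stmt-HodgeConjecture-24832`; #42F′ FACE-G organ plan (RULING M-158q (a)), letter L1 = (G-eq) «THE RESIDUE COMMUTES WITH ARCH LIE DERIVATIVES»
(desk K2Liu-p10 (g6) `SIG-FaceG-Letters` fae103b1553b751f §L1; LEAD F0P6-plan (g14) BATCH #106 (2) F2).
-/
import Summits.HodgeConjecture.HodgeConjecture.Theorems.K2LiuResidueMapLinear                   -- ★ 0c frame: `finiteDimensional_span_orbit_of_mem_span_tmul_of_isStd`, `isStandardSectionFamily_swTensorTwisted`, `continuous_swTensorTwisted`, `resNorm`, `resGen`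
import Summits.HodgeConjecture.HodgeConjecture.Theorems.K2LiuResidueLieDerivativeStandard        -- ★ G1-END `hasDerivAt_resGen_stdExtension_orbit_half`
import Summits.HodgeConjecture.HodgeConjecture.Theorems.K2LiuIwasawaHeightDerivContinuous       -- ★ (D-ht) `exists_heightDeriv_continuous_of_isStd`, `continuous_ofReal_mul`
import Summits.HodgeConjecture.HodgeConjecture.Theorems.K2LiuFaceGLetterDefs                    -- ★ p862888 (K2Liu-p10): the letter predicates `IsArchStable`, `genFamily`, `IsPoleClearedCont`, `HasArchDeriv`
import HarnessLib

/-!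
# Crux `HLiu418`, #42F′ FACE-G, letter L1 (G-eq) — `K2LiuResidueArchDerivRow`: THE RESIDUE OF #42F′'s GENERATOR COMMUTES WITH ARCHIMEDEAN LIE DERIVATIVES
# `∂_t|₀ resNorm P E (h·γ_X t) = resNorm P′ E′ h` whenever `∂_t|₀ sec x (h·γ_X t) = sec x′ h`

Cell `hodgecm-mathlib`, crux item hLiu418 = `stmt-HodgeConjecture-24832`, route of record `HCCMUnconditional`; squad K2 ∕ K2Liu, socket #42F′, FACE-G organ plan
of record (LEAD F0P6-plan (g14) RULING M-158q (a); desk K2Liu-p10 (g6) `SIG-FaceG-Letters` §L1, consumed BY NAME by the assembler F1 `K2LiuFaceGAssembler.faceG_of_organs`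
in its (deriv) step, jointly with ★ F3 `K2LiuLineThetaLiftArchDerivative` and `HasDerivAt.unique`).  THEOREMS ONLY (no `def`, no `instance`, no `notation`, no
named-fact hypothesis, no `sorry`); socket #41 BY VALUE (`h41`, bytes of U6 ED. 12 :289 = ★ 0c `K2LiuResidueMapLinear.exists_linear_residueMap`'s binder); lane
`--supports stmt-HodgeConjecture-24832 --as helper` (count-neutral helper; closes no socket by itself).

THE LETTER (p10 §L1, frame binders = ★ 0c's VERBATIM: `e : Fin 2 × Fin 1 ≃ Fin n`, `(lam, hlam, hwt)`, big frame `(eW, e′, dV′)`, `(χb, α, hχD)`, standard `𝒦`).  For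
`x ∈ D_V`, `x′ ∈ D_{V′}` (`V`, `V′` finite-dimensional and arch-`K`-stable, `harch`, `harch′`) write `g x s h := detChar α h · stdExt 𝒦 s₀ (swSectionTensor sB x) s h`
(`s₀ = (3 − n)∕2`, #42F′'s generator family, ★ ED. 6 (a)'s bytes) and `sec x h := g x s₀ h`.  **`residue_hasDerivAt_archExp`**: if `sec x′` is the right Lie derivative of
`sec x` along `γ_X = archExp hX` (`hD : ∀ h, HasDerivAt (t ↦ sec x (h·γ_X t)) (sec x′ h) 0`, BY VALUE — L3's producer), then for ANY pole-cleared continuations `(P, E)` of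
`E^Δ(·; g x)` and `(P′, E′)` of `E^Δ(·; g x′)` (two clauses each: holomorphy on `{0 < re}` and the `∏(s − p)·E^Δ` identity on `{n∕2 < re}`) and every `h ∈ H(𝔸)`:
**`HasDerivAt (t ↦ resNorm P E (h·γ_X t)) (resNorm P′ E′ h) 0`.**
PROOF = ★ G1-END `hasDerivAt_resGen_stdExtension_orbit_half` (`n = 2` from `e`, so `s₀ = ½` and the height-derivative family dies) at `φ := sec x`, `Xφ := sec x′`,
`H` := ★ (D-ht) `exists_heightDeriv_continuous_of_isStd`, with socket #41's three bundles `hex hex₁ hex₂` = `h41` at the STANDARD families `stdExt ½ (sec x) = g x`,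
`stdExt ½ (sec x′) = g x′` (§1 `twistedGen_eq_stdExtension_apply`: the family identity is `stdExtension`'s body + `mul_left_comm`; standardness ∕ continuity ★ 0c's road:
★ `finiteDimensional_span_orbit_of_mem_span_tmul_of_isStd` → ★ `isStandardSectionFamily_swTensorTwisted` under `hχD` → ★ `continuous_swTensorTwisted`) and `stdExt ½ (H · sec x)`
(★ `isStandardSectionFamily_heightDeriv_mul`, ★ `continuous_stdExtension` ∘ ★ `continuous_ofReal_mul`); finally ★ U0.2 `resGen_eq_resNorm_of_continuation` moves the two
`resGen`s onto the given `(P, E)`, `(P′, E′)`.  [KudlaRallis1994, §1 Thm. 1.1], [MoeglinWaldspurger1995, IV.1.9–IV.1.11], [Liu2021, Lem. B.12 pp. 103–104], [Tan1999, §1].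
HONEST LABEL.  Count-neutral helper; it retires nothing by itself: `HC_CM` is proved only modulo the 7 printed citations (2 remaining named inputs:
hLiu418 = `stmt-HodgeConjecture-24832`, h413 = `stmt-HodgeConjecture-24833`) until rung 0 closes.

References: [KudlaRallis1994] S. Kudla, S. Rallis, Ann. of Math. 140 (1994) §1 Thm. 1.1; [MoeglinWaldspurger1995] C. Mœglin, J.-L. Waldspurger (1995) II.1.7,
IV.1.9–IV.1.11; [Liu2021] Y. Liu, Camb. J. Math. 9 (2021) App. B Lem. B.12 pp. 103–104; [Tan1999] V. Tan, Canad. J. Math. 51 (1999) §1 p. 166.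
-/

set_option autoImplicit false
-- the mandated namespace repeats the single-problem summit's segment (`HodgeConjecture.HodgeConjecture`)
set_option linter.dupNamespace false

noncomputable section

open scoped Matrix Topology TensorProduct SchwartzMap Classical  -- `Classical`: the `Fintype` of real ∕ complex places inside `mixedSpace (L⁺)` (as in ★ U2f ∕ ★ 0c)
open NumberField NumberField.mixedEmbedding IsDedekindDomain MeasureTheory Filter
open Literature.NumberTheory.Automorphic Literature.NumberTheory.Automorphic.UnitaryGroup Literature.NumberTheory.GaloisRepresentations
open Literature.NumberTheory.GelbartRogawski1991 Literature.NumberTheory.GelbartRogawski1991.GRConstruction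
open Literature.NumberTheory.GelbartRogawski1991.GRConstruction.DoubledWeilDetTwist
open Literature.NumberTheory.GelbartRogawski1991.UnitaryDualPair
open Literature.NumberTheory.K2Lit.SiegelDoubled
open Literature.NumberTheory.Automorphic.IdeleClassGroup
open Literature.NumberTheory.Automorphic.Liu2021
open Literature.NumberTheory.Automorphic.Liu2021.Def411WeilCarriers
open Literature.NumberTheory.Automorphic.Liu2021.Def411WeilCarriersDoubling
open Literature.NumberTheory.Weil1964
open Literature.RepresentationTheory.Liu2021
open Literature.RepresentationTheory.HarrisKudlaSweet1996 (IsSplittingChar)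
open Summit.HodgeConjecture.HodgeConjecture.Cruxes.HLiu418.K2LiuFirstTermResidueFormDefs (resNorm)
open Summit.HodgeConjecture.HodgeConjecture.Cruxes.HLiu418.K2LiuFirstTermResidueGenDefs
open Summit.HodgeConjecture.HodgeConjecture.Cruxes.HLiu418.K2LiuSiegelWeilTensorGenerator
  (isStandardSectionFamily_swTensorTwisted continuous_swTensorTwisted)
open Summit.HodgeConjecture.HodgeConjecture.Cruxes.HLiu418.K2LiuTensorEmbArchFinParts (finiteDimensional_span_orbit_of_mem_span_tmul_of_isStd)
open Summit.HodgeConjecture.HodgeConjecture.Cruxes.HLiu418.K2LiuArchOneParameterOrbitDefs (archExp archExp_zero)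
open Summit.HodgeConjecture.HodgeConjecture.Cruxes.HLiu418.K2LiuResidueLieDerivativeStandard (hasDerivAt_resGen_stdExtension_orbit_half)
open Summit.HodgeConjecture.HodgeConjecture.Cruxes.HLiu418.K2LiuIwasawaHeightDerivContinuous (exists_heightDeriv_continuous_of_isStd continuous_ofReal_mul)
open Summit.HodgeConjecture.HodgeConjecture.Cruxes.HLiu418.K2LiuFlatSectionLieDerivative (isStandardSectionFamily_heightDeriv_mul)
open Summit.HodgeConjecture.HodgeConjecture.Cruxes.HLiu418.K2LiuSiegelWeilSectionContinuous (continuous_stdExtension)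
open Summit.HodgeConjecture.HodgeConjecture.Cruxes.HLiu418.K2LiuIwasawaDeltaUnimodular (IwasawaDatum.modDelta_eq_one_of_mem)
open Summit.HodgeConjecture.HodgeConjecture.Cruxes.HLiu418.K2LiuFaceGLetterDefs

namespace Summit.HodgeConjecture.HodgeConjecture.Cruxes.HLiu418.K2LiuResidueArchDerivRow

/-! ## §1 The family identity: #42F′'s generator IS the standard extension of its own `s₀`-member -/

section Identity

variable (L : Type) [Field L] [NumberField L] [IsCMField L]
variable {N M n : ℕ} (e : Fin N × Fin M ≃ Fin n)
  (dV : Fin N → L) (hdV : ∀ i, IsCMField.complexConj L (dV i) = dV i) (hdV0 : ∀ i, dV i ≠ 0)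
  (dW : Fin M → L) (hdW : ∀ i, IsCMField.complexConj L (dW i) = dW i) (hdW0 : ∀ i, dW i ≠ 0)

/-- **a character-twisted standard extension is the standard extension of its `s₀`-member**: for any `θ : H(𝔸) → ℂ`, Iwasawa datum `𝒦`, `s₀` and `ψ`,
`(s, h) ↦ θ(h) · stdExt 𝒦 s₀ ψ s h = stdExt 𝒦 s₀ (h ↦ θ(h) · stdExt 𝒦 s₀ ψ s₀ h)` — `stdExtension`'s body `|det_Δ p_h|^{2(s−s₀)} · ψ(h)` and `mul_left_comm`
(no `K`-absorption needed). [cite: KudlaRallis1994, §1] [cite: Tan1999, §1 p. 166] -/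
theorem twistedGen_eq_stdExtension_apply (θ : HA L e dV hdV dW hdW → ℂ) (𝒦 : IwasawaDatum L e dV hdV dW hdW) (s₀ : ℂ)
    (ψ : HA L e dV hdV dW hdW → ℂ) :
    (fun s h => θ h * stdExtension 𝒦 s₀ ψ s h) = stdExtension 𝒦 s₀ (fun h => θ h * stdExtension 𝒦 s₀ ψ s₀ h) := by
  funext s h
  simp only [stdExtension, sub_self, mul_zero, Complex.cpow_zero, one_mul]
  ring

end Identity

/-! ## §2 THE LETTER L1 (G-eq): the residue commutes with archimedean Lie derivatives -/

section Letter

/-- **L1 (G-eq) — THE RESIDUE OF #42F′'s GENERATOR COMMUTES WITH ARCHIMEDEAN LIE DERIVATIVES**, in the predicates of ★ `K2LiuFaceGLetterDefs` and with the binder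
list of ★ F1 `K2LiuFaceGAssembler.faceG_of_organs`'s hypothesis `hGeq` VERBATIM (so F1 is discharged BY NAME: `faceG_of_organs HL h41 residue_hasDerivAt_archExp …`).
Socket #41 BY VALUE (`h41`, U6 ED. 12 :289); frame of ★ 0c `exists_linear_residueMap` (standard `𝒦`, det-twist equation `χ_b³·α̃ = λ̃⁻¹`); two finite-dimensional
arch-stable `V`, `V′` (`IsArchStable`), `x ∈ D_V`, `x′ ∈ D_{V′}`, `X ∈ 𝔲`; `HasArchDeriv hX (sec x) (sec x′)` BY VALUE (`sec x = genFamily … x s₀`, L3's producer);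
ANY pole-cleared continuations `(P, E)`, `(P′, E′)` (`IsPoleClearedCont`).  Conclusion: `HasArchDeriv hX (resNorm P E) (resNorm P′ E′)`, i.e.
`∀ h, HasDerivAt (t ↦ resNorm P E (h·γ_X t)) (resNorm P′ E′ h) 0`.  Road: ★ G1-END `hasDerivAt_resGen_stdExtension_orbit_half` at `s₀ = ½` (`n = 2` from `e`), #41's
three bundles at the standard families `g x = stdExt ½ (sec x)`, `g x′`, `stdExt ½ (H·sec x)` (★ 0c's standardness road, §1, ★ `isStandardSectionFamily_heightDeriv_mul`,
★ (D-ht)), then ★ U0.2 `resGen_eq_resNorm_of_continuation`. [cite: KudlaRallis1994, §1 Thm. 1.1] [cite: MoeglinWaldspurger1995, IV.1.9–IV.1.11]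
[cite: Liu2021, Lem. B.12 pp. 103–104] [cite: Tan1999, §1 p. 166] -/
theorem residue_hasDerivAt_archExp
    (h41 : ∀ (L : Type) [Field L] [NumberField L] [IsCMField L] {n : ℕ} (e : Fin 2 × Fin 1 ≃ Fin n)
      (dV : Fin 2 → L) (hdV : ∀ i, IsCMField.complexConj L (dV i) = dV i) (hdV0 : ∀ i, dV i ≠ 0)
      (dW : Fin 1 → L) (hdW : ∀ i, IsCMField.complexConj L (dW i) = dW i) (hdW0 : ∀ i, dW i ≠ 0)
      (lam : Literature.NumberTheory.Automorphic.IdeleClassGroup L →ₜ* Circle) (hlam : IsConjugateSymplectic L lam),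
      HasWeight L lam 1 →
      ∀ (𝒦 : IwasawaDatum L e dV hdV dW hdW) (_h𝒦 : 𝒦.IsStd) (f : ℂ → HA L e dV hdV dW hdW → ℂ),
        IsStandardSectionFamily 𝒦 (toHeckeCharacter L lam⁻¹) f → (∀ s, Continuous (f s)) →
      ∃ (P : Finset ℂ) (Es : ℂ → HA L e dV hdV dW hdW → ℂ),
        (∀ h : HA L e dV hdV dW hdW, DifferentiableOn ℂ (fun s => Es s h) {s : ℂ | 0 < s.re}) ∧
        (∀ s : ℂ, 0 < s.re → Continuous (Es s)) ∧
        (∀ s : ℂ, 0 < s.re → ∀ (γ : ratH L e dV hdV dW hdW) (h : HA L e dV hdV dW hdW),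
          Es s ((γ : HA L e dV hdV dW hdW) * h) = Es s h) ∧
        (∀ (s : ℂ) (h : HA L e dV hdV dW hdW), (n : ℝ) / 2 < s.re →
          Es s h = (∏ p ∈ P, (s - p)) * eisensteinFamilyDelta L e dV hdV dW hdW f s h) ∧
        (∀ z : ℂ, 0 < z.re → ∃ C A r : ℝ, 0 < r ∧ ∀ s : ℂ, dist s z < r → ∀ h : HA L e dV hdV dW hdW,
          ‖Es s h‖ ≤ C * adelicHeightGL (n + n) L (h : GL (Fin (n + n)) (AdeleRing (𝓞 L) L)) ^ A))
    (L : Type) [Field L] [NumberField L] [IsCMField L] {n : ℕ} (e : Fin 2 × Fin 1 ≃ Fin n)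
    (dV : Fin 2 → L) (hdV : ∀ i, IsCMField.complexConj L (dV i) = dV i) (hdV0 : ∀ i, dV i ≠ 0)
    (dW : Fin 1 → L) (hdW : ∀ i, IsCMField.complexConj L (dW i) = dW i) (hdW0 : ∀ i, dW i ≠ 0)
    (lam : Literature.NumberTheory.Automorphic.IdeleClassGroup L →ₜ* Circle) (hlam : IsConjugateSymplectic L lam) (hwt : HasWeight L lam 1)
    {M' n' : ℕ} (eW : Fin 1 × Fin 3 ≃ Fin M') (e' : Fin 2 × Fin M' ≃ Fin n')
    (dV' : Fin 3 → L) (hdV' : ∀ k, IsCMField.complexConj L (dV' k) = dV' k) (hdV'0 : ∀ k, dV' k ≠ 0)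
    (χb : HeckeCharacter L) (hχbu : χb.IsUnitary) (hχbs : Literature.RepresentationTheory.HarrisKudlaSweet1996.IsSplittingChar L 1 χb)
    (α : UnitaryGroup.adelicOne (Fp L) L (IsCMField.complexConj L) →* ℂˣ) (hα : Continuous α)
    (hαrat : ∀ u : UnitaryGroup.adelicOne (Fp L) L (IsCMField.complexConj L),
      (u : Literature.NumberTheory.GaloisRepresentations.ideleGroup L) ∈ Literature.NumberTheory.GaloisRepresentations.principalIdeles L → α u = 1)
    (hχD : χb ^ 3 * DoubledWeilDetTwist.ratioHecke L α hα hαrat = toHeckeCharacter L lam⁻¹)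
    (𝒦 : IwasawaDatum L e dV hdV dW hdW) (h𝒦 : 𝒦.IsStd)
    (V : Submodule ℂ 𝓢(((Fin (n' + n')) → mixedSpace (Fp L)), ℂ)) (hVfd : FiniteDimensional ℂ V)
    (harch : IsArchStable L e dV hdV hdV0 dW hdW hdW0 eW e' dV' hdV' hdV'0 χb hχbu hχbs 𝒦 V)
    (x : ↥(Submodule.span ℂ {x : piSchwartzBruhat (Fp L) (Fin (n' + n')) |
        ∃ a ∈ V, ∃ f : FinSB (Fp L) (Fin (n' + n')), x = piSchwartzBruhatEquiv (Fp L) (Fin (n' + n')) (a ⊗ₜ[ℂ] f)}))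
    (X : Matrix (Fin (n + n)) (Fin (n + n)) (mixedSpace L)) (hX : X ∈ archSkew (Fp L) L (IsCMField.complexConj L) (n + n) (hermD L e dV hdV dW hdW))
    (V' : Submodule ℂ 𝓢(((Fin (n' + n')) → mixedSpace (Fp L)), ℂ)) (hV'fd : FiniteDimensional ℂ V')
    (harch' : IsArchStable L e dV hdV hdV0 dW hdW hdW0 eW e' dV' hdV' hdV'0 χb hχbu hχbs 𝒦 V')
    (x' : ↥(Submodule.span ℂ {x : piSchwartzBruhat (Fp L) (Fin (n' + n')) |
        ∃ a ∈ V', ∃ f : FinSB (Fp L) (Fin (n' + n')), x = piSchwartzBruhatEquiv (Fp L) (Fin (n' + n')) (a ⊗ₜ[ℂ] f)}))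
    -- `HasArchDeriv hX (sec x) (sec x′)`: `sec x′` is the right Lie derivative of `sec x` along `γ_X` (BY VALUE — L3's producer)
    (hD : HasArchDeriv L e dV hdV dW hdW hX
      (fun h => genFamily L e dV hdV hdV0 dW hdW hdW0 eW e' dV' hdV' hdV'0 χb hχbu hχbs α 𝒦 (x : piSchwartzBruhat (Fp L) (Fin (n' + n'))) ((((3 : ℕ) : ℂ) - (n : ℂ)) / 2) h)
      (fun h => genFamily L e dV hdV hdV0 dW hdW hdW0 eW e' dV' hdV' hdV'0 χb hχbu hχbs α 𝒦 (x' : piSchwartzBruhat (Fp L) (Fin (n' + n'))) ((((3 : ℕ) : ℂ) - (n : ℂ)) / 2) h))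
    -- `Cont x P E`, `Cont x′ P′ E′`: pole-cleared continuations (clauses (i), (iv) of #41)
    (P : Finset ℂ) (E : ℂ → HA L e dV hdV dW hdW → ℂ)
    (hPE : IsPoleClearedCont L e dV hdV hdV0 dW hdW hdW0 eW e' dV' hdV' hdV'0 χb hχbu hχbs α 𝒦 (x : piSchwartzBruhat (Fp L) (Fin (n' + n'))) P E)
    (P' : Finset ℂ) (E' : ℂ → HA L e dV hdV dW hdW → ℂ)
    (hPE' : IsPoleClearedCont L e dV hdV hdV0 dW hdW hdW0 eW e' dV' hdV' hdV'0 χb hχbu hχbs α 𝒦 (x' : piSchwartzBruhat (Fp L) (Fin (n' + n'))) P' E') :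
    HasArchDeriv L e dV hdV dW hdW hX (resNorm P E) (resNorm P' E') := by
  intro h
  haveI := hVfd
  haveI := hV'fd
  obtain ⟨hd, hiv⟩ := hPE
  obtain ⟨hd', hiv'⟩ := hPE'
  simp only [HasArchDeriv, genFamily] at hD
  unfold genFamily at hiv hiv'
  -- `n = 2`, so `s₀ = (3 − n)∕2 = ½`
  obtain rfl : n = 2 := by simpa using (Fintype.card_congr e).symm
  have hs0 : ((((3 : ℕ) : ℂ) - ((2 : ℕ) : ℂ)) / 2 : ℂ) = 1 / 2 := by norm_num
  rw [hs0] at hD hiv hiv'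
  -- the frame letters
  have hsB := isDoubledWeilRep_doubledWeilRep L e' dV hdV hdV0 (tensorFrame L dW eW dV') (tensorFrame_real L dW hdW eW dV' hdV')
    (tensorFrame_ne_zero L dW eW dV' hdW0 hdV'0) χb hχbu hχbs
  have hχu : (toHeckeCharacter L lam⁻¹).IsUnitary := isUnitary_toHeckeCharacter L lam⁻¹
  have hK : 𝒦.IsDeltaUnimodular := IwasawaDatum.modDelta_eq_one_of_mem L e dV hdV hdV0 dW hdW hdW0 𝒦
  -- ★ 0c's road: `K`-finiteness ⇒ the generator families `g x`, `g x′` are STANDARD for `(𝒦, λ̃⁻¹)` and continuous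
  have hKf := finiteDimensional_span_orbit_of_mem_span_tmul_of_isStd L e dV hdV dW hdW eW e' dV' hdV' hdV0 hdW0 hdV'0 h𝒦 hsB V harch x.2
  have hKf' := finiteDimensional_span_orbit_of_mem_span_tmul_of_isStd L e dV hdV dW hdW eW e' dV' hdV' hdV0 hdW0 hdV'0 h𝒦 hsB V' harch' x'.2
  have hstd : IsStandardSectionFamily 𝒦 (toHeckeCharacter L lam⁻¹)
      (fun s₁ h₁ => ((DoubledWeilDetTwist.detChar L e dV hdV hdV0 dW hdW hdW0 α h₁ : ℂˣ) : ℂ) *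
            stdExtension 𝒦 (1 / 2)
              (swSectionTensor L e dV hdV dW hdW eW e' dV' hdV' hdV0 hdW0 hdV'0
                (doubledWeilRep L e' dV hdV hdV0 (tensorFrame L dW eW dV') (tensorFrame_real L dW hdW eW dV' hdV')
                  (tensorFrame_ne_zero L dW eW dV' hdW0 hdV'0) χb hχbu hχbs)
                (x : piSchwartzBruhat (Fp L) (Fin (n' + n')))) s₁ h₁) := by
    have key := isStandardSectionFamily_swTensorTwisted L e dV hdV hdV0 dW hdW hdW0 eW e' dV' hdV' hdV'0 α (by norm_num) hsB 𝒦 _ hKf hα hαrat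
    rw [hχD, hs0] at key
    exact key
  have hstd' : IsStandardSectionFamily 𝒦 (toHeckeCharacter L lam⁻¹)
      (fun s₁ h₁ => ((DoubledWeilDetTwist.detChar L e dV hdV hdV0 dW hdW hdW0 α h₁ : ℂˣ) : ℂ) *
            stdExtension 𝒦 (1 / 2)
              (swSectionTensor L e dV hdV dW hdW eW e' dV' hdV' hdV0 hdW0 hdV'0
                (doubledWeilRep L e' dV hdV hdV0 (tensorFrame L dW eW dV') (tensorFrame_real L dW hdW eW dV' hdV')
                  (tensorFrame_ne_zero L dW eW dV' hdW0 hdV'0) χb hχbu hχbs)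
                (x' : piSchwartzBruhat (Fp L) (Fin (n' + n')))) s₁ h₁) := by
    have key := isStandardSectionFamily_swTensorTwisted L e dV hdV hdV0 dW hdW hdW0 eW e' dV' hdV' hdV'0 α (by norm_num) hsB 𝒦 _ hKf' hα hαrat
    rw [hχD, hs0] at key
    exact key
  have hcont : ∀ s : ℂ, Continuous fun h₁ => ((DoubledWeilDetTwist.detChar L e dV hdV hdV0 dW hdW hdW0 α h₁ : ℂˣ) : ℂ) *
      stdExtension 𝒦 (1 / 2) (swSectionTensor L e dV hdV dW hdW eW e' dV' hdV' hdV0 hdW0 hdV'0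
                (doubledWeilRep L e' dV hdV hdV0 (tensorFrame L dW eW dV') (tensorFrame_real L dW hdW eW dV' hdV')
                  (tensorFrame_ne_zero L dW eW dV' hdW0 hdV'0) χb hχbu hχbs)
                (x : piSchwartzBruhat (Fp L) (Fin (n' + n')))) s h₁ := fun s => by
    have key := continuous_swTensorTwisted L e dV hdV hdV0 dW hdW hdW0 eW e' dV' hdV' hdV'0 α (by norm_num) hsB 𝒦 _ hKf hα s
    rw [hs0] at key
    exact key
  have hcont' : ∀ s : ℂ, Continuous fun h₁ => ((DoubledWeilDetTwist.detChar L e dV hdV hdV0 dW hdW hdW0 α h₁ : ℂˣ) : ℂ) *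
      stdExtension 𝒦 (1 / 2) (swSectionTensor L e dV hdV dW hdW eW e' dV' hdV' hdV0 hdW0 hdV'0
                (doubledWeilRep L e' dV hdV hdV0 (tensorFrame L dW eW dV') (tensorFrame_real L dW hdW eW dV' hdV')
                  (tensorFrame_ne_zero L dW eW dV' hdW0 hdV'0) χb hχbu hχbs)
                (x' : piSchwartzBruhat (Fp L) (Fin (n' + n')))) s h₁ := fun s => by
    have key := continuous_swTensorTwisted L e dV hdV hdV0 dW hdW hdW0 eW e' dV' hdV' hdV'0 α (by norm_num) hsB 𝒦 _ hKf' hα s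
    rw [hs0] at key
    exact key
  -- the family identities `g x = stdExt ½ (sec x)`, `g x′ = stdExt ½ (sec x′)` (§1)
  have hGφ : (fun s₁ h₁ => ((DoubledWeilDetTwist.detChar L e dV hdV hdV0 dW hdW hdW0 α h₁ : ℂˣ) : ℂ) *
            stdExtension 𝒦 (1 / 2)
              (swSectionTensor L e dV hdV dW hdW eW e' dV' hdV' hdV0 hdW0 hdV'0
                (doubledWeilRep L e' dV hdV hdV0 (tensorFrame L dW eW dV') (tensorFrame_real L dW hdW eW dV' hdV')
                  (tensorFrame_ne_zero L dW eW dV' hdW0 hdV'0) χb hχbu hχbs)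
                (x : piSchwartzBruhat (Fp L) (Fin (n' + n')))) s₁ h₁) =
      stdExtension 𝒦 (1 / 2) (fun h₁ => ((DoubledWeilDetTwist.detChar L e dV hdV hdV0 dW hdW hdW0 α h₁ : ℂˣ) : ℂ) *
            stdExtension 𝒦 (1 / 2)
              (swSectionTensor L e dV hdV dW hdW eW e' dV' hdV' hdV0 hdW0 hdV'0
                (doubledWeilRep L e' dV hdV hdV0 (tensorFrame L dW eW dV') (tensorFrame_real L dW hdW eW dV' hdV')
                  (tensorFrame_ne_zero L dW eW dV' hdW0 hdV'0) χb hχbu hχbs)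
                (x : piSchwartzBruhat (Fp L) (Fin (n' + n')))) (1 / 2) h₁) :=
    twistedGen_eq_stdExtension_apply L e dV hdV dW hdW _ 𝒦 (1 / 2) _
  have hGXφ : (fun s₁ h₁ => ((DoubledWeilDetTwist.detChar L e dV hdV hdV0 dW hdW hdW0 α h₁ : ℂˣ) : ℂ) *
            stdExtension 𝒦 (1 / 2)
              (swSectionTensor L e dV hdV dW hdW eW e' dV' hdV' hdV0 hdW0 hdV'0
                (doubledWeilRep L e' dV hdV hdV0 (tensorFrame L dW eW dV') (tensorFrame_real L dW hdW eW dV' hdV')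
                  (tensorFrame_ne_zero L dW eW dV' hdW0 hdV'0) χb hχbu hχbs)
                (x' : piSchwartzBruhat (Fp L) (Fin (n' + n')))) s₁ h₁) =
      stdExtension 𝒦 (1 / 2) (fun h₁ => ((DoubledWeilDetTwist.detChar L e dV hdV hdV0 dW hdW hdW0 α h₁ : ℂˣ) : ℂ) *
            stdExtension 𝒦 (1 / 2)
              (swSectionTensor L e dV hdV dW hdW eW e' dV' hdV' hdV0 hdW0 hdV'0
                (doubledWeilRep L e' dV hdV hdV0 (tensorFrame L dW eW dV') (tensorFrame_real L dW hdW eW dV' hdV')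
                  (tensorFrame_ne_zero L dW eW dV' hdW0 hdV'0) χb hχbu hχbs)
                (x' : piSchwartzBruhat (Fp L) (Fin (n' + n')))) (1 / 2) h₁) :=
    twistedGen_eq_stdExtension_apply L e dV hdV dW hdW _ 𝒦 (1 / 2) _
  -- the section `φ := sec x` and its letters
  have hφ : IsSiegelDeltaSection L e dV hdV dW hdW (toHeckeCharacter L lam⁻¹) (1 / 2) (fun h₁ => ((DoubledWeilDetTwist.detChar L e dV hdV hdV0 dW hdW hdW0 α h₁ : ℂˣ) : ℂ) *
            stdExtension 𝒦 (1 / 2)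
              (swSectionTensor L e dV hdV dW hdW eW e' dV' hdV' hdV0 hdW0 hdV'0
                (doubledWeilRep L e' dV hdV hdV0 (tensorFrame L dW eW dV') (tensorFrame_real L dW hdW eW dV' hdV')
                  (tensorFrame_ne_zero L dW eW dV' hdW0 hdV'0) χb hχbu hχbs)
                (x : piSchwartzBruhat (Fp L) (Fin (n' + n')))) (1 / 2) h₁) :=
    hstd.1.1 (1 / 2)
  have hφc : Continuous (fun h₁ => ((DoubledWeilDetTwist.detChar L e dV hdV hdV0 dW hdW hdW0 α h₁ : ℂˣ) : ℂ) *
            stdExtension 𝒦 (1 / 2)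
              (swSectionTensor L e dV hdV dW hdW eW e' dV' hdV' hdV0 hdW0 hdV'0
                (doubledWeilRep L e' dV hdV hdV0 (tensorFrame L dW eW dV') (tensorFrame_real L dW hdW eW dV' hdV')
                  (tensorFrame_ne_zero L dW eW dV' hdW0 hdV'0) χb hχbu hχbs)
                (x : piSchwartzBruhat (Fp L) (Fin (n' + n')))) (1 / 2) h₁) := hcont (1 / 2)
  have hXφc : Continuous (fun h₁ => ((DoubledWeilDetTwist.detChar L e dV hdV hdV0 dW hdW hdW0 α h₁ : ℂˣ) : ℂ) *
            stdExtension 𝒦 (1 / 2)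
              (swSectionTensor L e dV hdV dW hdW eW e' dV' hdV' hdV0 hdW0 hdV'0
                (doubledWeilRep L e' dV hdV hdV0 (tensorFrame L dW eW dV') (tensorFrame_real L dW hdW eW dV' hdV')
                  (tensorFrame_ne_zero L dW eW dV' hdW0 hdV'0) χb hχbu hχbs)
                (x' : piSchwartzBruhat (Fp L) (Fin (n' + n')))) (1 / 2) h₁) := hcont' (1 / 2)
  have hφK : IsKFinite 𝒦 (fun h₁ => ((DoubledWeilDetTwist.detChar L e dV hdV hdV0 dW hdW hdW0 α h₁ : ℂˣ) : ℂ) *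
            stdExtension 𝒦 (1 / 2)
              (swSectionTensor L e dV hdV dW hdW eW e' dV' hdV' hdV0 hdW0 hdV'0
                (doubledWeilRep L e' dV hdV hdV0 (tensorFrame L dW eW dV') (tensorFrame_real L dW hdW eW dV' hdV')
                  (tensorFrame_ne_zero L dW eW dV' hdW0 hdV'0) χb hχbu hχbs)
                (x : piSchwartzBruhat (Fp L) (Fin (n' + n')))) (1 / 2) h₁) := hstd.2.1 (1 / 2)
  -- the height log-derivative `H` of the standard datum (★ (D-ht))
  obtain ⟨H, hH, hHK, hHc⟩ := exists_heightDeriv_continuous_of_isStd L e dV hdV hdV0 dW hdW hdW0 𝒦 hX h𝒦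
  -- socket #41's three bundles
  have hex : ∃ (P : Finset ℂ) (Es : ℂ → HA L e dV hdV dW hdW → ℂ),
      (∀ h : HA L e dV hdV dW hdW, DifferentiableOn ℂ (fun s => Es s h) {s : ℂ | 0 < s.re}) ∧
      (∀ s : ℂ, 0 < s.re → Continuous (Es s)) ∧
      (∀ s : ℂ, 0 < s.re → ∀ (γ : ratH L e dV hdV dW hdW) (h : HA L e dV hdV dW hdW),
        Es s ((γ : HA L e dV hdV dW hdW) * h) = Es s h) ∧
      (∀ (s : ℂ) (h : HA L e dV hdV dW hdW), ((2 : ℕ) : ℝ) / 2 < s.re →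
        Es s h = (∏ p ∈ P, (s - p)) * eisensteinFamilyDelta L e dV hdV dW hdW (stdExtension 𝒦 (1 / 2) (fun h₁ => ((DoubledWeilDetTwist.detChar L e dV hdV hdV0 dW hdW hdW0 α h₁ : ℂˣ) : ℂ) *
            stdExtension 𝒦 (1 / 2)
              (swSectionTensor L e dV hdV dW hdW eW e' dV' hdV' hdV0 hdW0 hdV'0
                (doubledWeilRep L e' dV hdV hdV0 (tensorFrame L dW eW dV') (tensorFrame_real L dW hdW eW dV' hdV')
                  (tensorFrame_ne_zero L dW eW dV' hdW0 hdV'0) χb hχbu hχbs)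
                (x : piSchwartzBruhat (Fp L) (Fin (n' + n')))) (1 / 2) h₁)) s h) ∧
      (∀ z : ℂ, 0 < z.re → ∃ C A r : ℝ, 0 < r ∧ ∀ s : ℂ, dist s z < r → ∀ h : HA L e dV hdV dW hdW,
        ‖Es s h‖ ≤ C * adelicHeightGL (2 + 2) L (h : GL (Fin (2 + 2)) (AdeleRing (𝓞 L) L)) ^ A) := by
    rw [← hGφ]
    exact h41 L e dV hdV hdV0 dW hdW hdW0 lam hlam hwt 𝒦 h𝒦 _ hstd hcont
  have hex₁ : ∃ (P : Finset ℂ) (Es : ℂ → HA L e dV hdV dW hdW → ℂ),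
      (∀ h : HA L e dV hdV dW hdW, DifferentiableOn ℂ (fun s => Es s h) {s : ℂ | 0 < s.re}) ∧
      (∀ s : ℂ, 0 < s.re → Continuous (Es s)) ∧
      (∀ s : ℂ, 0 < s.re → ∀ (γ : ratH L e dV hdV dW hdW) (h : HA L e dV hdV dW hdW),
        Es s ((γ : HA L e dV hdV dW hdW) * h) = Es s h) ∧
      (∀ (s : ℂ) (h : HA L e dV hdV dW hdW), ((2 : ℕ) : ℝ) / 2 < s.re →
        Es s h = (∏ p ∈ P, (s - p)) * eisensteinFamilyDelta L e dV hdV dW hdW (stdExtension 𝒦 (1 / 2) (fun h₁ => ((DoubledWeilDetTwist.detChar L e dV hdV hdV0 dW hdW hdW0 α h₁ : ℂˣ) : ℂ) *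
            stdExtension 𝒦 (1 / 2)
              (swSectionTensor L e dV hdV dW hdW eW e' dV' hdV' hdV0 hdW0 hdV'0
                (doubledWeilRep L e' dV hdV hdV0 (tensorFrame L dW eW dV') (tensorFrame_real L dW hdW eW dV' hdV')
                  (tensorFrame_ne_zero L dW eW dV' hdW0 hdV'0) χb hχbu hχbs)
                (x' : piSchwartzBruhat (Fp L) (Fin (n' + n')))) (1 / 2) h₁)) s h) ∧
      (∀ z : ℂ, 0 < z.re → ∃ C A r : ℝ, 0 < r ∧ ∀ s : ℂ, dist s z < r → ∀ h : HA L e dV hdV dW hdW,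
        ‖Es s h‖ ≤ C * adelicHeightGL (2 + 2) L (h : GL (Fin (2 + 2)) (AdeleRing (𝓞 L) L)) ^ A) := by
    rw [← hGXφ]
    exact h41 L e dV hdV hdV0 dW hdW hdW0 lam hlam hwt 𝒦 h𝒦 _ hstd' hcont'
  have hex₂ : ∃ (P : Finset ℂ) (Es : ℂ → HA L e dV hdV dW hdW → ℂ),
      (∀ h : HA L e dV hdV dW hdW, DifferentiableOn ℂ (fun s => Es s h) {s : ℂ | 0 < s.re}) ∧
      (∀ s : ℂ, 0 < s.re → Continuous (Es s)) ∧
      (∀ s : ℂ, 0 < s.re → ∀ (γ : ratH L e dV hdV dW hdW) (h : HA L e dV hdV dW hdW),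
        Es s ((γ : HA L e dV hdV dW hdW) * h) = Es s h) ∧
      (∀ (s : ℂ) (h : HA L e dV hdV dW hdW), ((2 : ℕ) : ℝ) / 2 < s.re →
        Es s h = (∏ p ∈ P, (s - p)) * eisensteinFamilyDelta L e dV hdV dW hdW (stdExtension 𝒦 (1 / 2) (fun y => (H y : ℂ) * (fun h₁ => ((DoubledWeilDetTwist.detChar L e dV hdV hdV0 dW hdW hdW0 α h₁ : ℂˣ) : ℂ) *
            stdExtension 𝒦 (1 / 2)
              (swSectionTensor L e dV hdV dW hdW eW e' dV' hdV' hdV0 hdW0 hdV'0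
                (doubledWeilRep L e' dV hdV hdV0 (tensorFrame L dW eW dV') (tensorFrame_real L dW hdW eW dV' hdV')
                  (tensorFrame_ne_zero L dW eW dV' hdW0 hdV'0) χb hχbu hχbs)
                (x : piSchwartzBruhat (Fp L) (Fin (n' + n')))) (1 / 2) h₁) y)) s h) ∧
      (∀ z : ℂ, 0 < z.re → ∃ C A r : ℝ, 0 < r ∧ ∀ s : ℂ, dist s z < r → ∀ h : HA L e dV hdV dW hdW,
        ‖Es s h‖ ≤ C * adelicHeightGL (2 + 2) L (h : GL (Fin (2 + 2)) (AdeleRing (𝓞 L) L)) ^ A) :=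
    h41 L e dV hdV hdV0 dW hdW hdW0 lam hlam hwt 𝒦 h𝒦 _
      (isStandardSectionFamily_heightDeriv_mul 𝒦 (1 / 2) hX hK hφ hφK hH hHK)
      (fun s => continuous_stdExtension L e dV hdV hdV0 dW hdW hdW0 𝒦 (1 / 2) (continuous_ofReal_mul hHc hφc) s)
  -- ★ G1-END at `s₀ = ½`, `t = 0`
  have key := hasDerivAt_resGen_stdExtension_orbit_half L e dV hdV hdV0 dW hdW hdW0 𝒦 hX (by norm_num) hχu hφ hφc hD hXφc hH hHc
    hex hex₁ hex₂ h 0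
  simp only [archExp_zero, mul_one] at key
  -- move both residue forms onto the given continuations (★ U0.2)
  have hE : resGen hex = resNorm P E := by
    refine resGen_eq_resNorm_of_continuation hex P E hd ?_
    rw [← hGφ]
    exact hiv
  have hE' : resGen hex₁ = resNorm P' E' := by
    refine resGen_eq_resNorm_of_continuation hex₁ P' E' hd' ?_
    rw [← hGXφ]
    exact hiv'
  rw [hE, hE'] at key
  exact key

/-- **L1-DX (G-eq, DIRECTED) — the letter of ★ `K2LiuFaceGAssemblerDirected.faceG_of_organs_directed`** (K2Liu-p10 (g6) ★ p863040): the same row for the Lie letters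
`X` in a direction class `DX` (instance of record: single-place `X`); the direction hypothesis is NOT used — the undirected row holds for every `X ∈ 𝔲` — so this is
`residue_hasDerivAt_archExp` with the extra binder `_hXD` in the assembler's position (discharge BY NAME:
`faceG_of_organs_directed DX HL h41 (residue_hasDerivAt_archExp_directed DX) …`). [cite: KudlaRallis1994, §1 Thm. 1.1] [cite: MoeglinWaldspurger1995, IV.1.9–IV.1.11] -/
theorem residue_hasDerivAt_archExp_directed
    (DX : ∀ (L : Type) [Field L] [NumberField L] [IsCMField L] {n : ℕ} (e : Fin 2 × Fin 1 ≃ Fin n)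
      (dV : Fin 2 → L) (_hdV : ∀ i, IsCMField.complexConj L (dV i) = dV i)
      (dW : Fin 1 → L) (_hdW : ∀ i, IsCMField.complexConj L (dW i) = dW i), Matrix (Fin (n + n)) (Fin (n + n)) (mixedSpace L) → Prop)
    (h41 : ∀ (L : Type) [Field L] [NumberField L] [IsCMField L] {n : ℕ} (e : Fin 2 × Fin 1 ≃ Fin n)
      (dV : Fin 2 → L) (hdV : ∀ i, IsCMField.complexConj L (dV i) = dV i) (hdV0 : ∀ i, dV i ≠ 0)
      (dW : Fin 1 → L) (hdW : ∀ i, IsCMField.complexConj L (dW i) = dW i) (hdW0 : ∀ i, dW i ≠ 0)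
      (lam : Literature.NumberTheory.Automorphic.IdeleClassGroup L →ₜ* Circle) (hlam : IsConjugateSymplectic L lam),
      HasWeight L lam 1 →
      ∀ (𝒦 : IwasawaDatum L e dV hdV dW hdW) (_h𝒦 : 𝒦.IsStd) (f : ℂ → HA L e dV hdV dW hdW → ℂ),
        IsStandardSectionFamily 𝒦 (toHeckeCharacter L lam⁻¹) f → (∀ s, Continuous (f s)) →
      ∃ (P : Finset ℂ) (Es : ℂ → HA L e dV hdV dW hdW → ℂ),
        (∀ h : HA L e dV hdV dW hdW, DifferentiableOn ℂ (fun s => Es s h) {s : ℂ | 0 < s.re}) ∧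
        (∀ s : ℂ, 0 < s.re → Continuous (Es s)) ∧
        (∀ s : ℂ, 0 < s.re → ∀ (γ : ratH L e dV hdV dW hdW) (h : HA L e dV hdV dW hdW),
          Es s ((γ : HA L e dV hdV dW hdW) * h) = Es s h) ∧
        (∀ (s : ℂ) (h : HA L e dV hdV dW hdW), (n : ℝ) / 2 < s.re →
          Es s h = (∏ p ∈ P, (s - p)) * eisensteinFamilyDelta L e dV hdV dW hdW f s h) ∧
        (∀ z : ℂ, 0 < z.re → ∃ C A r : ℝ, 0 < r ∧ ∀ s : ℂ, dist s z < r → ∀ h : HA L e dV hdV dW hdW,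
          ‖Es s h‖ ≤ C * adelicHeightGL (n + n) L (h : GL (Fin (n + n)) (AdeleRing (𝓞 L) L)) ^ A))
    (L : Type) [Field L] [NumberField L] [IsCMField L] {n : ℕ} (e : Fin 2 × Fin 1 ≃ Fin n)
    (dV : Fin 2 → L) (hdV : ∀ i, IsCMField.complexConj L (dV i) = dV i) (hdV0 : ∀ i, dV i ≠ 0)
    (dW : Fin 1 → L) (hdW : ∀ i, IsCMField.complexConj L (dW i) = dW i) (hdW0 : ∀ i, dW i ≠ 0)
    (lam : Literature.NumberTheory.Automorphic.IdeleClassGroup L →ₜ* Circle) (hlam : IsConjugateSymplectic L lam) (hwt : HasWeight L lam 1)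
    {M' n' : ℕ} (eW : Fin 1 × Fin 3 ≃ Fin M') (e' : Fin 2 × Fin M' ≃ Fin n')
    (dV' : Fin 3 → L) (hdV' : ∀ k, IsCMField.complexConj L (dV' k) = dV' k) (hdV'0 : ∀ k, dV' k ≠ 0)
    (χb : HeckeCharacter L) (hχbu : χb.IsUnitary) (hχbs : Literature.RepresentationTheory.HarrisKudlaSweet1996.IsSplittingChar L 1 χb)
    (α : UnitaryGroup.adelicOne (Fp L) L (IsCMField.complexConj L) →* ℂˣ) (hα : Continuous α)
    (hαrat : ∀ u : UnitaryGroup.adelicOne (Fp L) L (IsCMField.complexConj L),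
      (u : Literature.NumberTheory.GaloisRepresentations.ideleGroup L) ∈ Literature.NumberTheory.GaloisRepresentations.principalIdeles L → α u = 1)
    (hχD : χb ^ 3 * DoubledWeilDetTwist.ratioHecke L α hα hαrat = toHeckeCharacter L lam⁻¹)
    (𝒦 : IwasawaDatum L e dV hdV dW hdW) (h𝒦 : 𝒦.IsStd)
    (V : Submodule ℂ 𝓢(((Fin (n' + n')) → mixedSpace (Fp L)), ℂ)) (hVfd : FiniteDimensional ℂ V)
    (harch : IsArchStable L e dV hdV hdV0 dW hdW hdW0 eW e' dV' hdV' hdV'0 χb hχbu hχbs 𝒦 V)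
    (x : ↥(Submodule.span ℂ {x : piSchwartzBruhat (Fp L) (Fin (n' + n')) |
        ∃ a ∈ V, ∃ f : FinSB (Fp L) (Fin (n' + n')), x = piSchwartzBruhatEquiv (Fp L) (Fin (n' + n')) (a ⊗ₜ[ℂ] f)}))
    (X : Matrix (Fin (n + n)) (Fin (n + n)) (mixedSpace L)) (hX : X ∈ archSkew (Fp L) L (IsCMField.complexConj L) (n + n) (hermD L e dV hdV dW hdW))
    (_hXD : DX L e dV hdV dW hdW X)
    (V' : Submodule ℂ 𝓢(((Fin (n' + n')) → mixedSpace (Fp L)), ℂ)) (hV'fd : FiniteDimensional ℂ V')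
    (harch' : IsArchStable L e dV hdV hdV0 dW hdW hdW0 eW e' dV' hdV' hdV'0 χb hχbu hχbs 𝒦 V')
    (x' : ↥(Submodule.span ℂ {x : piSchwartzBruhat (Fp L) (Fin (n' + n')) |
        ∃ a ∈ V', ∃ f : FinSB (Fp L) (Fin (n' + n')), x = piSchwartzBruhatEquiv (Fp L) (Fin (n' + n')) (a ⊗ₜ[ℂ] f)}))
    -- `HasArchDeriv hX (sec x) (sec x′)`: `sec x′` is the right Lie derivative of `sec x` along `γ_X` (BY VALUE — L3's producer)
    (hD : HasArchDeriv L e dV hdV dW hdW hX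
      (fun h => genFamily L e dV hdV hdV0 dW hdW hdW0 eW e' dV' hdV' hdV'0 χb hχbu hχbs α 𝒦 (x : piSchwartzBruhat (Fp L) (Fin (n' + n'))) ((((3 : ℕ) : ℂ) - (n : ℂ)) / 2) h)
      (fun h => genFamily L e dV hdV hdV0 dW hdW hdW0 eW e' dV' hdV' hdV'0 χb hχbu hχbs α 𝒦 (x' : piSchwartzBruhat (Fp L) (Fin (n' + n'))) ((((3 : ℕ) : ℂ) - (n : ℂ)) / 2) h))
    -- `Cont x P E`, `Cont x′ P′ E′`: pole-cleared continuations (clauses (i), (iv) of #41)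
    (P : Finset ℂ) (E : ℂ → HA L e dV hdV dW hdW → ℂ)
    (hPE : IsPoleClearedCont L e dV hdV hdV0 dW hdW hdW0 eW e' dV' hdV' hdV'0 χb hχbu hχbs α 𝒦 (x : piSchwartzBruhat (Fp L) (Fin (n' + n'))) P E)
    (P' : Finset ℂ) (E' : ℂ → HA L e dV hdV dW hdW → ℂ)
    (hPE' : IsPoleClearedCont L e dV hdV hdV0 dW hdW hdW0 eW e' dV' hdV' hdV'0 χb hχbu hχbs α 𝒦 (x' : piSchwartzBruhat (Fp L) (Fin (n' + n'))) P' E') :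
    HasArchDeriv L e dV hdV dW hdW hX (resNorm P E) (resNorm P' E') :=
  residue_hasDerivAt_archExp h41 L e dV hdV hdV0 dW hdW hdW0 lam hlam hwt eW e' dV' hdV' hdV'0 χb hχbu hχbs α hα hαrat hχD 𝒦 h𝒦
    V hVfd harch x X hX V' hV'fd harch' x' hD P E hPE P' E' hPE'

end Letter

end Summit.HodgeConjecture.HodgeConjecture.Cruxes.HLiu418.K2LiuResidueArchDerivRow

end
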